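import Mathlib.LinearAlgebra.Matrix.PosDef
import Literature.Combinatorics.SimpleGraph.LasserreStableBound
import Mathlib.Analysis.SpecialFunctions.Pow.Real
import Mathlib.Order.Filter.AtTopBot.CountablyGenerated
import Mathlib.Order.LiminfLimsup
import Mathlib.Topology.Sequences
import Mathlib.Topology.Order.OrderClosed
import Mathlib.Topology.Algebra.Order.LiminfLimsup
import Mathlib.Topology.MetricSpace.Pseudo.Pi
import HarnessLib

/-!
# Ventures/CertifiedQuantumChemistry — Rows/ClaimNAnalyticStep.lean: the ANALYTIC SKELETON of
# CLAIM N (the `liminf` half of the strong-coupling limit): a-priori bounds from `2 × 2` minors,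
# closedness of the PSD cone under scaled congruences, and "compactness + closed-limit inclusion ⇒
# the scaled optimum is eventually above every `a < v(P)`"

HONEST FRAMING (verbatim): certified bounds for a stated model Hamiltonian in a stated basis; not a
claim about the real molecule beyond that model. The programmes this file speaks about are the
finite-`U` two-positivity RELAXATIONS of the cell's structure ladder and their AUXILIARY
strong-coupling limit programmes `X_∞`; nothing here is a state, a row, a claim node or a value of
record, and no constant of the conjecture leaf `Rows/ConjectureSU2.lean` is touched.

Seat rdm-B (gen 35), zero compute; theorems only (no `def`). This is the LOWER-HALF companion of
`Rows/GenericLiftAnalyticStep.lean` (gen 30, the `limsup` half = LEMMA GL). CLAIM N (HOME/INBOX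
«WORDS RDMB-46 (rdm-B)» L765 (ii), accepted words-grade in `STRUCTURE.md` §2.2.13 (ii)) reads:
for `X ∈ {DQG, DQG+S²}`, even `L`, `t = 1`, `ε := 1/U`,
`liminf_{U→∞} U·OPT_X(L;U) ≥ v(P)` for `P = X_∞¹FS(L, X)`. Its words-proof has four steps —
(1) A-PRIORI BOUNDS (every scaled variable is bounded along a minimising sequence: the typed hop
bound of `Rows/StrongCouplingBookkeeping`, `OPT ≤ E₀ < 0`, and "inside any PSD block
`|B_{rJ}|² ≤ B_{rr}·B_{JJ}` bounds every border entry `/ε` and every `J–J′` entry `/ε²`"),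
(2) COMPACTNESS (pass to a convergent subsequence), (3) CLOSEDNESS constraint by constraint of `P`
("order-0 blocks PSD (limits of PSD matrices); the BORDERED blocks are limits of the congruences
`diag(1, 1/ε)·B·diag(1, 1/ε)` of PSD matrices; `Gc_x` is the limit of the congruence
`[Id | w_0/ε | … | w_{L−1}/ε]` of `Ĝ ⪰ 0`; exact linear rows pass to the limit; rows with
dropped `O(ε²)/ε` remainders hold in the limit"), (4) OBJECTIVE (`U·⟨H⟩` is EXACTLY the
`P`-objective of the scaled variables at every `n`) — and L765 itself records what was missing:
"ingredients not yet typed as ONE Lean statement: the compactness/closedness bookkeeping". This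
file TYPES that bookkeeping from abstract hypotheses of exactly those shapes (the model-specific
identities — which rows the emitted programme has, the hop bound, the `Ĝ` Schur lemma — stay the
words' and the certificates' business, as in the GL file):

* §1 **the `2 × 2`-MINOR MECHANISM.** The minor bound `(B i j)² ≤ B i i · B j j` of a positive
  semidefinite real matrix is the tree's `Literature.Combinatorics.SimpleGraph.psd_sq_apply_le`
  (imported and reused, not restated); `ClaimN.abs_apply_le_of_diag_le_sq` /
  `abs_apply_le_sqrt_mul_sqrt_mul` — hence `B i i ≤ p²`, `B j j ≤ q²` ⇒ `|B i j| ≤ p q` (with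
  `p = √P`, `q = √Q·ε`: border entries are `O(ε)` when the corner diagonal is `O(ε²)`; with both
  `O(ε²)`: the `J–J′` entries are `O(ε²)`); `le_sq_div_of_mul_le_sqrt` — the scalar a-priori step
  "`U·s − C√s ≤ OPT ≤ 0` forces `s ≤ (C/U)² = C²ε²`" (`s = Σ_i d_i`, the double occupancy).
* §2 `ClaimN.posSemidef_of_tendsto` — the PSD cone of real symmetric matrices is CLOSED under
  entrywise limits along any nontrivial filter; `posSemidef_of_tendsto_congruence` — so is the limit
  of ANY congruences `T(a)ᵀ B(a) T(a)` of PSD matrices (the `[Id | W/ε]` congruence of `Ĝ` giving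
  `Gc_x`); `posSemidef_of_tendsto_scaled` — in particular with the diagonal weights `ε^{-w(i)}`
  (`w = 0` on order-0 rows, `w = 1` on border rows): if `B(a) ⪰ 0` and
  `B(a) i j / ε(a)^{w i + w j} → Y i j` then `Y ⪰ 0` — the words' `diag(1, 1/ε)·B·diag(1, 1/ε)`, whose
  limit has border column `lim B_{rJ}/ε` and corner `lim B_{JJ′}/ε²`; `row_of_tendsto` /
  `row_of_tendsto_add` — a linear row that holds exactly (resp. up to a remainder `→ 0`) along a
  convergent sequence holds at the limit; `abs_le_of_tendsto` — boxes are closed.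
* §3 `ClaimN.eventually_forall_lt` — **THE `liminf` STEP**, pure topology: index filter `l`
  (countably generated: `U → ∞` along `ℕ`, `ℚ` or `ℝ`), feasible sets `F i ⊆ K` eventually, `K`
  SEQUENTIALLY COMPACT, objectives `f i`, a limit programme (`F∞`, `f∞`); HYPOTHESIS (= steps (3)+(4)
  along subsequences): whenever `u_k → l`, `x_k ∈ F (u_k)` and `x_k → y`, then `y ∈ F∞` and
  `liminf_k f (u_k) (x_k) ≥ f∞ y` (spelled: eventually above every `b < f∞ y`); CONCLUSION: for every
  `a` below all limit objective values, EVENTUALLY (in `l`) every feasible `x` of `F i` has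
  `a < f i x` — i.e. `liminf_i OPT(i) ≥ v(P)`, written without boundedness side conditions exactly as
  the GL file writes its `limsup`. Corollaries: `eventually_le_sInf` (the value form),
  `le_liminf_of_forall_lt` (Mathlib's `Filter.liminf`, under the one side condition it needs),
  `eventually_forall_lt_pi` (the cell's instance: finitely many real variables, `K` a box — step (1)),
  `tendsto_obj_of_vanishing` (an objective `g + ε·h` converges continuously to `g` — step (4)'s
  shape), and `tendsto_of_eventually_between` — THE PUNCHLINE joining this file to the GL file: the
  lower half ("eventually above every `a < v`") and the upper half ("eventually below every `a > v`",
  `GenericLift.eventually_lt_of_lt`) together say `U·OPT_X(L;U) → v(X_∞¹FS(L, X))`, i.e. the limit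
  EXISTS — the mechanism behind the existence clause of S-U, never its proof for a given `L` (that
  needs both halves INSTANTIATED on the emitted programme, which is the certificates' business).

Scalars: `ℝ` throughout (the cell's field; the exact arithmetic of the checkers lives in `ℚ` or
`ℚ(√2) ⊂ ℝ` and every sign verified there holds verbatim in `ℝ`). Everything is PROVED (0 sorry).
References (docstring-only, no CITED-FACTS entry): lower semicontinuity of optimal values under
Γ-convergence with equi-coercivity, e.g. A. Braides, *Γ-convergence for Beginners* (OUP 2002)
Thm 1.21, G. Dal Maso, *An Introduction to Γ-convergence* (Birkhäuser 1993) Thm 7.8; closedness of the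
PSD cone and the `2 × 2` principal-minor inequality, e.g. R. A. Horn, C. R. Johnson, *Matrix Analysis*
(2013) §7.1; the rest is elementary.
-/

namespace Summit.Ventures.CertifiedQuantumChemistry

open Matrix Finset Filter Topology Set

namespace ClaimN

/-! ### §1 A-priori bounds: the `2 × 2`-minor mechanism and the scalar step -/

section Minors

variable {n : Type*} [Fintype n] [DecidableEq n]

/-- **THE `2 × 2`-MINOR MECHANISM.** The minor bound itself — `(B i j)² ≤ B i i · B j j` for a
positive semidefinite real matrix — is already in the tree as
`Literature.Combinatorics.SimpleGraph.psd_sq_apply_le` (imported, not restated). Its use in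
CLAIM N (1): border / corner entries are as small as their diagonals allow — `B i i ≤ p²`,
`B j j ≤ q²` (`p, q ≥ 0`) ⇒ `|B i j| ≤ p·q`. With `p² = P` (an order-0 row) and `q² = Q·ε²` (a
corner diagonal of size `O(ε²)`, e.g. a scaled double occupancy) this is "every border entry `/ε`
is bounded" (`|B_{rJ}| ≤ √(PQ)·ε`); with both diagonals `O(ε²)` it is "every `J–J′` entry `/ε²`
is bounded". [folklore; Horn–Johnson §7.1] -/
theorem abs_apply_le_of_diag_le_sq {B : Matrix n n ℝ} (hB : B.PosSemidef) (i j : n) {p q : ℝ}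
    (hp : 0 ≤ p) (hq : 0 ≤ q) (hi : B i i ≤ p ^ 2) (hj : B j j ≤ q ^ 2) : |B i j| ≤ p * q := by
  have h1 : B i j ^ 2 ≤ (p * q) ^ 2 :=
    calc B i j ^ 2 ≤ B i i * B j j := Literature.Combinatorics.SimpleGraph.psd_sq_apply_le hB i j
      _ ≤ p ^ 2 * q ^ 2 := mul_le_mul hi hj hB.diag_nonneg (le_trans hB.diag_nonneg hi)
      _ = (p * q) ^ 2 := by ring
  calc |B i j| = Real.sqrt (B i j ^ 2) := (Real.sqrt_sq_eq_abs _).symm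
    _ ≤ Real.sqrt ((p * q) ^ 2) := Real.sqrt_le_sqrt h1
    _ = p * q := Real.sqrt_sq (mul_nonneg hp hq)

/-- In the scaled form used by the words: `B i i ≤ P`, `B j j ≤ Q·ε²` with `P, Q, ε ≥ 0` ⇒
`|B i j| ≤ √P·√Q·ε`, i.e. `|B i j| / ε` is bounded by a constant independent of `ε`. [folklore] -/
theorem abs_apply_le_sqrt_mul_sqrt_mul {B : Matrix n n ℝ} (hB : B.PosSemidef) (i j : n)
    {P Q ε : ℝ} (hP : 0 ≤ P) (hQ : 0 ≤ Q) (hε : 0 ≤ ε) (hi : B i i ≤ P) (hj : B j j ≤ Q * ε ^ 2) :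
    |B i j| ≤ Real.sqrt P * Real.sqrt Q * ε := by
  have h := abs_apply_le_of_diag_le_sq hB i j (Real.sqrt_nonneg P)
    (mul_nonneg (Real.sqrt_nonneg Q) hε) (by rwa [Real.sq_sqrt hP])
    (by rw [mul_pow, Real.sq_sqrt hQ]; exact hj)
  simpa [mul_assoc] using h

/-- **THE SCALAR A-PRIORI STEP.** If `s ≥ 0`, `U > 0` and `U·s ≤ C·√s` (the words:
`OPT ≥ −C√(Σd) + U·Σd` from the hop bound, and `OPT ≤ E₀ ≤ 0`), then `s ≤ (C/U)² = C²ε²` — the total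
double occupancy, hence every scaled variable built from it, is bounded along the sequence.
[folklore] -/
theorem le_sq_div_of_mul_le_sqrt {s U C : ℝ} (hs : 0 ≤ s) (hU : 0 < U)
    (h : U * s ≤ C * Real.sqrt s) : s ≤ (C / U) ^ 2 := by
  rcases hs.eq_or_lt with h0 | hpos
  · rw [← h0]; positivity
  have hr : 0 < Real.sqrt s := Real.sqrt_pos.2 hpos
  have h1 : U * Real.sqrt s ≤ C := by
    have h2 : U * Real.sqrt s * Real.sqrt s ≤ C * Real.sqrt s := by
      rw [mul_assoc, Real.mul_self_sqrt hs]; exact h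
    exact le_of_mul_le_mul_right h2 hr
  have h3 : Real.sqrt s ≤ C / U := by
    rw [le_div_iff₀ hU]; linarith [mul_comm U (Real.sqrt s)]
  calc s = Real.sqrt s ^ 2 := (Real.sq_sqrt hs).symm
    _ ≤ (C / U) ^ 2 := pow_le_pow_left₀ hr.le h3 2

end Minors

/-! ### §2 Closedness: the PSD cone under limits and scaled congruences; rows; boxes -/

section Closed

variable {α : Type*} {l : Filter α} {n m : Type*} [Fintype n] [Fintype m]

/-- The cone of positive semidefinite real matrices is CLOSED under entrywise limits along any
nontrivial filter: symmetry passes to the limit and so does `xᵀ M x ≥ 0` for each fixed `x`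
("order-0 blocks PSD (limits of PSD matrices)"). (Same statement and proof as
`Literature.Analysis.Matrix.NonnegTaylorHadamard.posSemidef_of_tendsto`; restated here to keep this
file's import closure elementary.) [folklore; Horn–Johnson §7.1] -/
theorem posSemidef_of_tendsto [l.NeBot] {M : α → Matrix n n ℝ} {Y : Matrix n n ℝ}
    (hM : ∀ᶠ a in l, (M a).PosSemidef)
    (hlim : ∀ i j, Tendsto (fun a => M a i j) l (𝓝 (Y i j))) : Y.PosSemidef := by
  refine PosSemidef.of_dotProduct_mulVec_nonneg (IsHermitian.ext fun i j => ?_) fun x => ?_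
  · rw [star_trivial]
    refine tendsto_nhds_unique (hlim j i) ((hlim i j).congr' ?_)
    exact hM.mono fun a ha => by simpa using (ha.isHermitian.apply i j).symm
  · have ht : Tendsto (fun a => star x ⬝ᵥ (M a *ᵥ x)) l (𝓝 (star x ⬝ᵥ (Y *ᵥ x))) := by
      simp only [dotProduct, mulVec]
      exact tendsto_finsetSum _ fun i _ =>
        (tendsto_finsetSum _ fun j _ => (hlim i j).mul_const _).const_mul _
    exact ge_of_tendsto ht (hM.mono fun a ha => ha.dotProduct_mulVec_nonneg x)

/-- **LIMITS OF CONGRUENCES OF PSD MATRICES ARE PSD.** If `B(a) ⪰ 0` eventually and the congruences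
`T(a)ᵀ B(a) T(a)` (any real `T(a)`, square or not) converge entrywise to `Y`, then `Y ⪰ 0`. CLAIM N
(3) uses it twice: the bordered blocks (`T = diag(1, 1/ε)`, next lemma) and `Gc_x` as the limit of the
congruence `T(ε) = [Id | w_0/ε | … | w_{L−1}/ε]` of `Ĝ ⪰ 0`. [folklore] -/
theorem posSemidef_of_tendsto_congruence [l.NeBot] {B : α → Matrix n n ℝ} (T : α → Matrix n m ℝ)
    {Y : Matrix m m ℝ} (hB : ∀ᶠ a in l, (B a).PosSemidef)
    (hlim : ∀ i j, Tendsto (fun a => ((T a)ᵀ * B a * T a) i j) l (𝓝 (Y i j))) : Y.PosSemidef :=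
  posSemidef_of_tendsto
    (hB.mono fun a ha => by simpa using ha.conjTranspose_mul_mul_same (T a)) hlim

omit [Fintype m] in
/-- Entries of a diagonal congruence: `(diag d · B · diag d) i j = d i · B i j · d j`. (plumbing)
[folklore] -/
theorem diagonal_transpose_mul_mul_diagonal_apply [DecidableEq n] (d : n → ℝ) (B : Matrix n n ℝ)
    (i j : n) : ((diagonal d)ᵀ * B * diagonal d) i j = d i * B i j * d j := by
  rw [diagonal_transpose, mul_diagonal, diagonal_mul]

/-- **THE SCALED-CONGRUENCE LIMIT (bordered blocks).** Give every index an `ε`-ORDER `w i ∈ ℕ`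
(`0` on order-0 rows, `1` on border rows `J`). If `B(a) ⪰ 0` eventually and the SCALED entries
`B(a) i j / ε(a)^{w i + w j}` converge to `Y i j`, then `Y ⪰ 0`: `Y` is the entrywise limit of the
congruences `diag(ε^{-w}) · B · diag(ε^{-w})` — the words' `diag(1, 1/ε)·B·diag(1, 1/ε)`, whose limit
has border column `lim B_{rJ}/ε` and corner `lim B_{JJ′}/ε²`. (No sign or non-vanishing hypothesis
on `ε` is needed for the identity; in the cell `ε = 1/U > 0`.) [folklore] -/
theorem posSemidef_of_tendsto_scaled [l.NeBot] [DecidableEq n] {B : α → Matrix n n ℝ} (w : n → ℕ)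
    (ε : α → ℝ) {Y : Matrix n n ℝ} (hB : ∀ᶠ a in l, (B a).PosSemidef)
    (hlim : ∀ i j, Tendsto (fun a => B a i j / ε a ^ (w i + w j)) l (𝓝 (Y i j))) :
    Y.PosSemidef := by
  refine posSemidef_of_tendsto_congruence (fun a => diagonal fun i => (ε a)⁻¹ ^ w i) hB
    fun i j => ?_
  refine (hlim i j).congr' (Eventually.of_forall fun a => ?_)
  dsimp only
  rw [diagonal_transpose_mul_mul_diagonal_apply, div_eq_mul_inv, ← inv_pow, pow_add]
  ring

variable {V : Type*} [Fintype V]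

/-- Exact linear rows pass to the limit: if `Σ_v A v · x_k v = b` for all (large) `k` and `x_k → y`
then `Σ_v A v · y v = b` ("ties / charge2 / trace rows are EXACT linear identities at every finite
`U` … and pass to the limit"). [folklore] -/
theorem row_of_tendsto [l.NeBot] (A : V → ℝ) (b : ℝ) {x : α → V → ℝ} {y : V → ℝ}
    (hrow : ∀ᶠ k in l, ∑ v, A v * x k v = b) (hx : Tendsto x l (𝓝 y)) : ∑ v, A v * y v = b := by
  have ht : Tendsto (fun k => ∑ v, A v * x k v) l (𝓝 (∑ v, A v * y v)) :=
    tendsto_finsetSum _ fun v _ => ((continuous_apply v).tendsto y |>.comp hx).const_mul _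
  exact tendsto_nhds_unique ht (tendsto_const_nhds.congr' (hrow.mono fun k hk => hk.symm))

/-- Rows with a vanishing remainder pass to the limit: if `Σ_v A v · x_k v = b + r_k` with `r_k → 0`
and `x_k → y` then `Σ_v A v · y v = b` ("charge1 rows hold at finite `U` up to the dropped
`O(ε²)/ε` remainders, which vanish"). [folklore] -/
theorem row_of_tendsto_add [l.NeBot] (A : V → ℝ) (b : ℝ) {x : α → V → ℝ} {y : V → ℝ}
    {r : α → ℝ} (hrow : ∀ᶠ k in l, ∑ v, A v * x k v = b + r k) (hr : Tendsto r l (𝓝 0))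
    (hx : Tendsto x l (𝓝 y)) : ∑ v, A v * y v = b := by
  have ht : Tendsto (fun k => ∑ v, A v * x k v) l (𝓝 (∑ v, A v * y v)) :=
    tendsto_finsetSum _ fun v _ => ((continuous_apply v).tendsto y |>.comp hx).const_mul _
  have ht' : Tendsto (fun k => b + r k) l (𝓝 b) := by simpa using hr.const_add b
  exact tendsto_nhds_unique ht (ht'.congr' (hrow.mono fun k hk => hk.symm))

omit [Fintype V] in
/-- Boxes are closed: `|x_k v| ≤ ρ` eventually and `x_k → y` ⇒ `|y v| ≤ ρ`. [folklore] -/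
theorem abs_le_of_tendsto [l.NeBot] {x : α → V → ℝ} {y : V → ℝ} (v : V) {ρ : ℝ}
    (hbox : ∀ᶠ k in l, |x k v| ≤ ρ) (hx : Tendsto x l (𝓝 y)) : |y v| ≤ ρ :=
  le_of_tendsto (((continuous_apply v).tendsto y |>.comp hx).abs) hbox

end Closed

/-! ### §3 The `liminf` step -/

section Liminf

variable {ι E : Type*} [TopologicalSpace E] {l : Filter ι} [l.IsCountablyGenerated]

/-- **THE `liminf` STEP OF CLAIM N (compactness + closed-limit inclusion).** Index filter `l`
(`U → ∞`; countably generated), feasible sets `F i` eventually inside a SEQUENTIALLY COMPACT set `K`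
(step (1): the a-priori bounds), objectives `f i`, and a limit programme with feasible set `F∞` and
objective `f∞`. HYPOTHESIS (steps (3) + (4) along subsequences): whenever `u_k → l`, `x_k ∈ F (u_k)`
and `x_k → y`, the limit point is `P`-feasible (`y ∈ F∞`) and `liminf_k f (u_k) x_k ≥ f∞ y`
(spelled: for every `b < f∞ y`, eventually `b < f (u_k) x_k`). CONCLUSION: for every `a` with
`a < f∞ y` for all `y ∈ F∞` (every `a < v(P)`), EVENTUALLY in `l` every feasible `x ∈ F i` has
`a < f i x` — `liminf_U U·OPT_X(L;U) ≥ v(P)` without boundedness side conditions. (Proof: else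
frequently some feasible `x_i` has `f i x_i ≤ a`; extract a sequence `u_k → l` (countable generation),
a convergent subsequence in `K` (step (2)), and contradict the hypothesis at its limit.)
[folklore; Braides Thm 1.21 / Dal Maso Thm 7.8] -/
theorem eventually_forall_lt {K : Set E} (hK : IsSeqCompact K) {F : ι → Set E} {Finf : Set E}
    {f : ι → E → ℝ} {finf : E → ℝ} (hFK : ∀ᶠ i in l, F i ⊆ K)
    (hΓ : ∀ (u : ℕ → ι) (x : ℕ → E) (y : E), Tendsto u atTop l → (∀ k, x k ∈ F (u k)) →
      Tendsto x atTop (𝓝 y) → y ∈ Finf ∧ ∀ b < finf y, ∀ᶠ k in atTop, b < f (u k) (x k))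
    {a : ℝ} (ha : ∀ y ∈ Finf, a < finf y) : ∀ᶠ i in l, ∀ x ∈ F i, a < f i x := by
  by_contra hne
  have h1 : ∃ᶠ i in l, ∃ x ∈ F i, f i x ≤ a := by
    rw [not_eventually] at hne
    refine hne.mono fun i hi => ?_
    push Not at hi
    exact hi
  have hfr : ∃ᶠ i in l, (∃ x ∈ F i, f i x ≤ a) ∧ F i ⊆ K := h1.and_eventually hFK
  obtain ⟨u, hu, hu'⟩ := exists_seq_forall_of_frequently hfr
  choose x hxF hxa using fun k => (hu' k).1
  have hxK : ∀ k, x k ∈ K := fun k => (hu' k).2 (hxF k)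
  obtain ⟨y, -, ψ, hψ, hy⟩ := hK hxK
  obtain ⟨hyF, hlim⟩ :=
    hΓ (u ∘ ψ) (x ∘ ψ) y (hu.comp hψ.tendsto_atTop) (fun k => hxF (ψ k)) hy
  obtain ⟨k, hk⟩ := (hlim a (ha y hyF)).exists
  exact absurd (hxa (ψ k)) (not_le.2 hk)

/-- The same with the hypothesis split into its two named parts — CLOSED-LIMIT INCLUSION of the
feasible sets (step (3)) and CONTINUOUS CONVERGENCE of the objectives along feasible sequences
(step (4)). [folklore] -/
theorem eventually_forall_lt_of_closed_of_tendsto {K : Set E} (hK : IsSeqCompact K) {F : ι → Set E}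
    {Finf : Set E} {f : ι → E → ℝ} {finf : E → ℝ} (hFK : ∀ᶠ i in l, F i ⊆ K)
    (hcl : ∀ (u : ℕ → ι) (x : ℕ → E) (y : E), Tendsto u atTop l → (∀ k, x k ∈ F (u k)) →
      Tendsto x atTop (𝓝 y) → y ∈ Finf)
    (hobj : ∀ (u : ℕ → ι) (x : ℕ → E) (y : E), Tendsto u atTop l → (∀ k, x k ∈ F (u k)) →
      Tendsto x atTop (𝓝 y) → Tendsto (fun k => f (u k) (x k)) atTop (𝓝 (finf y)))
    {a : ℝ} (ha : ∀ y ∈ Finf, a < finf y) : ∀ᶠ i in l, ∀ x ∈ F i, a < f i x :=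
  eventually_forall_lt hK hFK (fun u x y hu hx hy =>
    ⟨hcl u x y hu hx hy, fun b hb => (tendsto_order.1 (hobj u x y hu hx hy)).1 b hb⟩) ha

omit [TopologicalSpace E] in
/-- From `a < inf (f∞ '' F∞)` (bounded below) to the pointwise form `∀ y ∈ F∞, a < f∞ y` used
above. (plumbing) [folklore] -/
theorem forall_lt_of_lt_csInf {Finf : Set E} {finf : E → ℝ} (hbdd : BddBelow (finf '' Finf))
    {a : ℝ} (ha : a < sInf (finf '' Finf)) : ∀ y ∈ Finf, a < finf y :=
  fun y hy => lt_of_lt_of_le ha (csInf_le hbdd ⟨y, hy, rfl⟩)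

/-- **VALUE FORM.** Under the hypotheses of `eventually_forall_lt`, for every `a` below all limit
objective values, eventually `a ≤ OPT(i) := inf (f i '' F i)` on nonempty feasible sets — the
`liminf_U U·OPT_X(L;U) ≥ v(P)` of CLAIM N read value by value. [folklore] -/
theorem eventually_le_sInf {K : Set E} (hK : IsSeqCompact K) {F : ι → Set E} {Finf : Set E}
    {f : ι → E → ℝ} {finf : E → ℝ} (hFK : ∀ᶠ i in l, F i ⊆ K)
    (hΓ : ∀ (u : ℕ → ι) (x : ℕ → E) (y : E), Tendsto u atTop l → (∀ k, x k ∈ F (u k)) →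
      Tendsto x atTop (𝓝 y) → y ∈ Finf ∧ ∀ b < finf y, ∀ᶠ k in atTop, b < f (u k) (x k))
    {a : ℝ} (ha : ∀ y ∈ Finf, a < finf y) :
    ∀ᶠ i in l, (F i).Nonempty → a ≤ sInf (f i '' F i) := by
  filter_upwards [eventually_forall_lt hK hFK hΓ ha] with i hi hne
  exact le_csInf (hne.image _) (by rintro _ ⟨x, hx, rfl⟩; exact (hi x hx).le)

/-- **`Filter.liminf` FORM.** If moreover the feasible sets are eventually nonempty, `g i` IS the
optimal value `inf (f i '' F i)` eventually, and `g` is eventually bounded above along `l` (in the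
cell: `U·OPT(U) ≤ U·E₀(U) → −4t²·h(L)·…`, a bounded quantity) — the one side condition Mathlib's
conditionally complete `liminf` needs — then `v ≤ liminf g` for every `v` with `v ≤ f∞` on `F∞`
pointwise-strictly-approached, stated as: `(∀ a < v, ∀ y ∈ F∞, a < f∞ y) → v ≤ liminf g l`.
[folklore] -/
theorem le_liminf_of_forall_lt [l.NeBot] {K : Set E} (hK : IsSeqCompact K) {F : ι → Set E}
    {Finf : Set E} {f : ι → E → ℝ} {finf : E → ℝ} (hFK : ∀ᶠ i in l, F i ⊆ K)
    (hΓ : ∀ (u : ℕ → ι) (x : ℕ → E) (y : E), Tendsto u atTop l → (∀ k, x k ∈ F (u k)) →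
      Tendsto x atTop (𝓝 y) → y ∈ Finf ∧ ∀ b < finf y, ∀ᶠ k in atTop, b < f (u k) (x k))
    {g : ι → ℝ} (hne : ∀ᶠ i in l, (F i).Nonempty) (hg : ∀ᶠ i in l, g i = sInf (f i '' F i))
    {M : ℝ} (hM : ∀ᶠ i in l, g i ≤ M) {v : ℝ} (hv : ∀ a < v, ∀ y ∈ Finf, a < finf y) :
    v ≤ liminf g l := by
  refine le_of_forall_lt_imp_le_of_dense fun a hav => ?_
  refine le_liminf_of_le (isCoboundedUnder_ge_of_eventually_le l hM) ?_
  filter_upwards [eventually_le_sInf hK hFK hΓ (hv a hav), hne, hg] with i hi hne' hgi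
  rw [hgi]; exact hi hne'

/-- **THE CELL'S INSTANCE (step (1) + (2)): finitely many real variables in a box.** `E = V → ℝ`
(`V` finite: the order-0 pair and all scaled variables), `K` = the box `Π_v [−R v, R v]` given by
the a-priori bounds; a box is sequentially compact, so `eventually_forall_lt` applies verbatim.
[folklore] -/
theorem eventually_forall_lt_pi {V : Type*} [Fintype V] {F : ι → Set (V → ℝ)} {Finf : Set (V → ℝ)}
    {f : ι → (V → ℝ) → ℝ} {finf : (V → ℝ) → ℝ} (R : V → ℝ)
    (hFK : ∀ᶠ i in l, ∀ x ∈ F i, ∀ v, |x v| ≤ R v)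
    (hΓ : ∀ (u : ℕ → ι) (x : ℕ → V → ℝ) (y : V → ℝ), Tendsto u atTop l → (∀ k, x k ∈ F (u k)) →
      Tendsto x atTop (𝓝 y) → y ∈ Finf ∧ ∀ b < finf y, ∀ᶠ k in atTop, b < f (u k) (x k))
    {a : ℝ} (ha : ∀ y ∈ Finf, a < finf y) : ∀ᶠ i in l, ∀ x ∈ F i, a < f i x := by
  have hK : IsSeqCompact (Set.pi Set.univ fun v => Set.Icc (-R v) (R v)) :=
    (isCompact_univ_pi fun v => isCompact_Icc).isSeqCompact
  refine eventually_forall_lt hK (hFK.mono fun i hi x hx => ?_) hΓ ha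
  exact fun v _ => abs_le.1 (hi x hx v)

omit [l.IsCountablyGenerated] in
/-- **STEP (4)'s SHAPE: an objective `g + ε·h` converges continuously to `g`.** If `g, h` are
continuous, `ε → 0` along `l`, `u_k → l` and `x_k → y`, then `g (x_k) + ε(u_k)·h (x_k) → g y` — so an
objective that is the limit objective PLUS `ε` times a continuous correction satisfies the objective
half of `hΓ` (with `Tendsto`, hence with `liminf`). (In CLAIM N (4) the correction is even absent:
`U·⟨H⟩` is EXACTLY the `P`-objective of the scaled variables.) [folklore] -/
theorem tendsto_obj_of_vanishing {g h : E → ℝ} (hg : Continuous g) (hh : Continuous h) {ε : ι → ℝ}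
    (hε : Tendsto ε l (𝓝 0)) {u : ℕ → ι} (hu : Tendsto u atTop l) {x : ℕ → E} {y : E}
    (hx : Tendsto x atTop (𝓝 y)) :
    Tendsto (fun k => g (x k) + ε (u k) * h (x k)) atTop (𝓝 (g y)) := by
  have h1 : Tendsto (fun k => g (x k)) atTop (𝓝 (g y)) := (hg.tendsto y).comp hx
  have h2 : Tendsto (fun k => ε (u k) * h (x k)) atTop (𝓝 (0 * h y)) :=
    (hε.comp hu).mul ((hh.tendsto y).comp hx)
  simpa using h1.add h2

omit [l.IsCountablyGenerated] in
/-- **THE PUNCHLINE (this file + the GL file ⇒ the limit EXISTS).** If the scaled optimum `g` is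
eventually above every `a < v` (this file: CLAIM N, `liminf ≥ v`) and eventually below every `a > v`
(`GenericLift.eventually_lt_of_lt`: LEMMA GL, `limsup ≤ v`), then `g → v` along `l`:
`lim_U U·OPT_X(L;U)` EXISTS and equals `v(X_∞¹FS(L, X))` — the mechanism behind S-U's existence
clause, never its proof for a given `L`. [folklore] -/
theorem tendsto_of_eventually_between {g : ι → ℝ} {v : ℝ} (hlo : ∀ a < v, ∀ᶠ i in l, a < g i)
    (hhi : ∀ a > v, ∀ᶠ i in l, g i < a) : Tendsto g l (𝓝 v) :=
  tendsto_order.2 ⟨hlo, hhi⟩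

end Liminf

end ClaimN

end Summit.Ventures.CertifiedQuantumChemistry
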